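import Summits.SmoothPoincare4.SmoothPoincare4.Theorems.ConvexBisectionAcyclicBisectionExistsSeamTwistSignStraighten
import Summits.SmoothPoincare4.SmoothPoincare4.Theorems.ConvexBisectionAcyclicBisectionExistsSeamTwistSignLocal
import Summits.SmoothPoincare4.SmoothPoincare4.Theorems.ConvexBisectionAcyclicBisectionExistsSeamTwistSignConnected
import HarnessLib

/-!
# Seam transport, ST4 (4b + 4c): the global twisting sign of a page-preserving seam map
(wave 5, brick X3-5b of sub-node ST4 `node_ST4_twistSign` of node T3c-2 `node_seam_transport` of stub
`stub_T3_dualPresentation` (T3), line `modp-braid-orbits`, crux `ConvexBisection.AcyclicBisectionExists`,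
item stmt-SmoothPoincare4-10508; registered sub-goal `helper_seam_twistSign_global`)

For the data `(D, bX, Ψ)` of a fibred model with the page clause, the TWISTING DETERMINANT of the seam
map `F = seamB D bX Ψ` at a point `y` of the boundary 3-manifold is
`twistDet y = pageDet (bdDeriv (S_1 ∘ F) y) y`, `S = strIso g (‖w (F y)‖ / 2)` the universal
straightening of ST2 at the canonical margin (`…SeamTwistSignStraighten.lean`); its sign `twistSign y = ±1`
is the page-orientation character of the seam at `y`.  This file proves:

* §1 at a flat page point off the cores `twistDet y ≠ 0`, and EVERY flattening of the seam — the
  universal one at any admissible margin, or `R_1 ∘ F` for ANY fibred ambient isotopy `R` with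
  `R_1 (F y)` flat — has page determinant a POSITIVE multiple of `twistDet y` (`pageDet_flatten_eq`);
* §2 `twistSign` is locally constant on the flat part of `∂ Base g ∖ cores` (continuity of the page
  determinant of a FIXED universal straightening, `helper_pageDet_bdDeriv_continuousAt`, and comparison
  of margins), hence CONSTANT there (`twistSign_eq`: the set is preconnected,
  `helper_flatOffCores_preconnected`);
* §3 **the global sign** (`helper_seam_twistSign_global`): there is ONE `s₀ = ±1` such that for every
  flat page point `y` off the cores, every unit `c` with `y ∈ page g c` and every fibred ambient isotopy
  `R` with `R_1 (F y) ∈ page g c`, `s₀ · pageDet (bdDeriv (R_1 ∘ F) y) y > 0` — the sign that ST4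
  attaches to the page twisting of every transported framed page knot.

Everything is proved; no named facts, no `sorry`.  References: J. B. Etnyre, T. Fuller, IMRN 2006,
Thm. 1 (proof, p. 8) [EtnyreFuller2006]; R. İ. Baykur, AGT 6 (2006), Thm. 5.1 (proof, p. 13)
[Baykur2006].
-/

noncomputable section

set_option linter.dupNamespace false

open scoped Manifold ContDiff Topology ComplexConjugate

namespace Summit.SmoothPoincare4.SmoothPoincare4.Theorems.AcyclicBisectionExists.ModpBraidOrbits

open Set Function Filter Complex
open Literature.Topology.FourManifolds Literature.Topology.FourManifolds.HandleAttachingMap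
  Literature.Topology.FourManifolds.BoundaryManifold Literature.Topology.FourManifolds.LefschetzBase
  Literature.Geometry.Symplectic

variable {g : ℕ}

section Sign

variable {ι : Type} [Finite ι] {h : ι → HandleAttachingMap 3 2 (Base g)}
  {X : Type} [TopologicalSpace X] [ChartedSpace (EuclideanHalfSpace 4) X] [IsManifold (𝓡∂ 4) ∞ X]
  (D : MultiAttachmentData h (𝓡∂ 4) X) (bX : BoundaryData (𝓡∂ 4) X (𝓡 3)) [Nonempty bX.carrier]
  (Ψ : bX.carrier ≃ₘ⟮𝓡 3, 𝓡 3⟯ (bBase g).carrier)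

/-! ## §1 The twisting determinant and its sign -/

/-- The canonical straightening margin at `y`: half of `‖w (seamB y)‖`. [folklore] -/
def seamMargin (y : (bBase g).carrier) : ℝ := ‖w g (seamB D bX Ψ y).1‖ / 2

/-- **The twisting determinant of the seam at `y`**: the page determinant of the boundary ambient
differential of `S_1 ∘ seamB` at `y`, `S` the universal straightening at the canonical margin
(junk `0` where the margin vanishes). [cite: EtnyreFuller2006, Thm. 1 (proof, p. 8)] -/
def twistDet (y : (bBase g).carrier) : ℝ :=
  if hm : 0 < seamMargin D bX Ψ y then
    pageDet g (bdDeriv g ((strIso g (seamMargin D bX Ψ y) hm).toFun 1 ∘ seamB D bX Ψ) y) y.1.1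
  else 0

/-- **The twisting sign of the seam at `y`** (`±1`). [cite: EtnyreFuller2006, Thm. 1 (proof, p. 8)] -/
def twistSign (y : (bBase g).carrier) : ℤ := if 0 < twistDet D bX Ψ y then 1 else -1

omit [IsManifold (𝓡∂ 4) ∞ X] in
/-- The twisting sign is `±1`. [folklore] -/
theorem twistSign_eq_one_or (y : (bBase g).carrier) : twistSign D bX Ψ y = 1 ∨ twistSign D bX Ψ y = -1 := by
  unfold twistSign; split_ifs <;> simp

variable (hpage : ∀ (y : bX.carrier) (a : ↥(coresComplement h)), bX.incl y = D.jA a →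
    ∃ c : ℝ, 0 < c ∧ w g ((bBase g).incl (Ψ y)).1 = (c : ℂ) * w g (a : Base g).1)

include hpage in
/-- At a flat page point off the cores the canonical margin is positive and below `‖w (seamB y)‖`.
[folklore] -/
theorem seamMargin_pos {y : (bBase g).carrier} (hy : (y.1 : Base g) ∈ coresComplement h) {c : ℂ}
    (hc : ‖c‖ = 1) (hyc : y.1 ∈ page g c) :
    0 < seamMargin D bX Ψ y ∧ seamMargin D bX Ψ y ≤ ‖w g (seamB D bX Ψ y).1‖ := by
  obtain ⟨r, hr, hrw⟩ := w_seamB_dir D bX Ψ hpage hy hyc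
  have hn : ‖w g (seamB D bX Ψ y).1‖ = r := by
    rw [hrw, norm_mul, hc, mul_one, Complex.norm_real, Real.norm_eq_abs, abs_of_pos hr]
  unfold seamMargin
  rw [hn]
  constructor <;> linarith

include hpage in
/-- **Every universal straightening at an admissible margin has page determinant a positive multiple of
the twisting determinant.** [cite: Baykur2006, Thm. 5.1 (proof, p. 13)] -/
theorem pageDet_str_eq {m : ℝ} (hm : 0 < m) {y : (bBase g).carrier} (hy : (y.1 : Base g) ∈ coresComplement h)
    {c : ℂ} (hc : ‖c‖ = 1) (hyc : y.1 ∈ page g c) (hmw : m ≤ ‖w g (seamB D bX Ψ y).1‖) :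
    ∃ κ : ℝ, 0 < κ ∧ pageDet g (bdDeriv g ((strIso g m hm).toFun 1 ∘ seamB D bX Ψ) y) y.1.1 =
      κ * twistDet D bX Ψ y := by
  obtain ⟨hm₀, hm₀w⟩ := seamMargin_pos D bX Ψ hpage hy hc hyc
  unfold twistDet
  rw [dif_pos hm₀]
  exact pageDet_seam_compare_str D bX Ψ hpage hm₀ hm hy hc hyc hm₀w hmw

include hpage in
/-- **The twisting determinant does not vanish** at a flat page point off the cores. [cite: EtnyreFuller2006, Thm. 1 (proof, p. 8)] -/
theorem twistDet_ne_zero {y : (bBase g).carrier} (hy : (y.1 : Base g) ∈ coresComplement h) {c : ℂ}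
    (hc : ‖c‖ = 1) (hyc : y.1 ∈ page g c) : twistDet D bX Ψ y ≠ 0 := by
  obtain ⟨hm₀, hm₀w⟩ := seamMargin_pos D bX Ψ hpage hy hc hyc
  unfold twistDet
  rw [dif_pos hm₀]
  exact pageDet_seam_str_ne_zero D bX Ψ hpage hm₀ hy hc hyc hm₀w

include hpage in
/-- **Every fibred flattening of the seam has page determinant a positive multiple of the twisting
determinant**: for a fibred ambient isotopy `R` with `R_1 (seamB y) ∈ page g c`.
[cite: Baykur2006, Thm. 5.1 (proof, p. 13)] -/
theorem pageDet_flatten_eq (R : AmbientIsotopy (𝓡∂ 4) (Base g))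
    (hρR : ∀ (t : ℝ) (x : Base g), rho g (R.toFun t x).1 = rho g x.1)
    (hdirR : ∀ (t : ℝ) (x : Base g), ∃ r : ℝ, 0 < r ∧ w g (R.toFun t x).1 = (r : ℂ) * w g x.1)
    {y : (bBase g).carrier} (hy : (y.1 : Base g) ∈ coresComplement h) {c : ℂ} (hc : ‖c‖ = 1)
    (hyc : y.1 ∈ page g c) (hR1 : R.toFun 1 (seamB D bX Ψ y) ∈ page g c) :
    ∃ κ : ℝ, 0 < κ ∧ pageDet g (bdDeriv g (R.toFun 1 ∘ seamB D bX Ψ) y) y.1.1 = κ * twistDet D bX Ψ y := by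
  set p₀ := seamB D bX Ψ y with hp₀
  -- a margin below the `‖w‖`-values of the orbit `R_t p₀`, `t ∈ [0, 1]`
  have hcont : Continuous fun t : ℝ => ‖w g (R.toFun t p₀).1‖ :=
    ((contDiff_w g).continuous.comp (continuous_subtype_val.comp
      (R.contMDiff.continuous.comp (continuous_id.prodMk continuous_const)))).norm
  obtain ⟨t₀, ht₀, hmin⟩ := isCompact_Icc.exists_isMinOn (nonempty_Icc.2 (zero_le_one' ℝ)) hcont.continuousOn
  set m := ‖w g (R.toFun t₀ p₀).1‖ with hm_def
  have hw0 : w g p₀.1 ≠ 0 := by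
    obtain ⟨r, hr, hrw⟩ := w_seamB_dir D bX Ψ hpage hy hyc
    rw [hrw]
    refine mul_ne_zero (by exact_mod_cast hr.ne') ?_
    rintro rfl; simp at hc
  have hm : 0 < m := by
    obtain ⟨r, hr, hrw⟩ := hdirR t₀ p₀
    rw [hm_def, hrw, norm_mul, Complex.norm_real, Real.norm_eq_abs, abs_of_pos hr]
    exact mul_pos hr (norm_pos_iff.2 hw0)
  have hmle : ∀ t ∈ Icc (0 : ℝ) 1, m ≤ ‖w g (R.toFun t p₀).1‖ := fun t ht => hmin ht
  obtain ⟨κ₁, hκ₁, h₁⟩ := pageDet_seam_compare D bX Ψ hpage R hρR hdirR hm hy hc hyc hR1 hmle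
  have hmw : m ≤ ‖w g (seamB D bX Ψ y).1‖ := by
    have := hmle 0 ⟨le_rfl, zero_le_one⟩
    rwa [R.map_zero] at this
  obtain ⟨κ₂, hκ₂, h₂⟩ := pageDet_str_eq D bX Ψ hpage hm hy hc hyc hmw
  exact ⟨κ₁ * κ₂, mul_pos hκ₁ hκ₂, by rw [h₁, h₂]; ring⟩

/-! ## §2 Local constancy of the twisting sign -/

include hpage in
/-- **The twisting sign is locally constant on the flat part of `∂ Base g ∖ cores`.** [cite: EtnyreFuller2006, Thm. 1 (proof, p. 8)] -/
theorem twistSign_eventually_eq {y₀ : (bBase g).carrier} (hy₀ : (y₀.1 : Base g) ∈ coresComplement h)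
    {c : ℂ} (hc : ‖c‖ = 1) (hy₀c : y₀.1 ∈ page g c) :
    ∀ᶠ y in 𝓝 y₀, (y.1 : Base g) ∈ coresComplement h → ‖cx y.1.1‖ ^ 2 < 4 →
      twistSign D bX Ψ y = twistSign D bX Ψ y₀ := by
  obtain ⟨hm₀, hm₀w⟩ := seamMargin_pos D bX Ψ hpage hy₀ hc hy₀c
  set m₀ := seamMargin D bX Ψ y₀ with hm₀_def
  set S := strIso g m₀ hm₀ with hS
  set f : (bBase g).carrier → ℝ := fun y => pageDet g (bdDeriv g (S.toFun 1 ∘ seamB D bX Ψ) y) y.1.1 with hf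
  -- `f` is continuous at `y₀` and `f y₀ = twistDet y₀ ≠ 0`
  have hGs : ContMDiffOn (𝓡 3) (𝓡∂ 4) ∞ (S.toFun 1 ∘ seamB D bX Ψ) (seamDom h) :=
    (S.contMDiff_toFun 1).comp_contMDiffOn (contMDiffOn_seamB D bX Ψ)
  have hfat : ContinuousAt f y₀ :=
    continuousAt_pageDet_bdDeriv isOpen_seamDom hy₀ hGs (flat_of_mem_page hc hy₀c).1
  have hf₀ : f y₀ = twistDet D bX Ψ y₀ := by
    unfold twistDet; rw [dif_pos hm₀]
  have hf₀ne : f y₀ ≠ 0 := by rw [hf₀]; exact twistDet_ne_zero D bX Ψ hpage hy₀ hc hy₀c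
  -- near `y₀`: `f` keeps its sign, and the margin `m₀` stays admissible
  have hsign : ∀ᶠ y in 𝓝 y₀, |f y - f y₀| < |f y₀| := by
    have := Metric.tendsto_nhds.1 hfat |f y₀| (abs_pos.2 hf₀ne)
    filter_upwards [this] with y hy
    rwa [Real.dist_eq] at hy
  have hwc : ContinuousAt (fun y : (bBase g).carrier => ‖w g (seamB D bX Ψ y).1‖) y₀ :=
    ((contDiff_w g).continuous.continuousAt.comp (continuous_subtype_val.continuousAt.comp
      (contMDiffAt_seamB D bX Ψ hy₀).continuousAt)).norm
  have hmarg : ∀ᶠ y in 𝓝 y₀, m₀ < ‖w g (seamB D bX Ψ y).1‖ := by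
    refine hwc.eventually (lt_mem_nhds ?_)
    show m₀ < ‖w g (seamB D bX Ψ y₀).1‖
    rw [hm₀_def]; unfold seamMargin
    have : 0 < ‖w g (seamB D bX Ψ y₀).1‖ := by rw [hm₀_def] at hm₀; unfold seamMargin at hm₀; linarith
    linarith
  filter_upwards [hsign, hmarg] with y hys hym hy hyflat
  -- `y` is a flat page point: direction `2 w`
  obtain ⟨c', hc', hyc'⟩ := exists_mem_page_of_flat hyflat ((RegularSublevel.mem_boundary_iff _ _).1 y.2)
  obtain ⟨κ, hκ, hκe⟩ := pageDet_str_eq D bX Ψ hpage hm₀ hy hc' hyc' hym.le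
  have hfy : f y = κ * twistDet D bX Ψ y := hκe
  -- same sign
  have key : (0 < twistDet D bX Ψ y) ↔ (0 < twistDet D bX Ψ y₀) := by
    rw [← hf₀, ← mul_pos_iff_of_pos_left hκ, ← hfy]
    constructor
    · intro h; by_contra h'; push Not at h'
      have : f y₀ < 0 := lt_of_le_of_ne h' hf₀ne
      rw [abs_of_neg this] at hys
      have := (abs_lt.1 hys).2; linarith
    · intro h
      rw [abs_of_pos h] at hys
      have := (abs_lt.1 hys).1; linarith
  unfold twistSign
  by_cases h0 : 0 < twistDet D bX Ψ y₀
  · rw [if_pos h0, if_pos (key.2 h0)]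
  · rw [if_neg h0, if_neg (fun h' => h0 (key.1 h'))]

end Sign

/-! ## §3 Global constancy and the global sign -/

section Global

variable {l : List ((Fin g ⊕ Fin g → ℤ) × Bool)} {h : Fin l.length → HandleAttachingMap 3 2 (Base g)}
  (hlink : IsLefschetzLink g l h)
  {X : Type} [TopologicalSpace X] [ChartedSpace (EuclideanHalfSpace 4) X] [IsManifold (𝓡∂ 4) ∞ X]
  (D : MultiAttachmentData h (𝓡∂ 4) X) (bX : BoundaryData (𝓡∂ 4) X (𝓡 3)) [Nonempty bX.carrier]
  (Ψ : bX.carrier ≃ₘ⟮𝓡 3, 𝓡 3⟯ (bBase g).carrier)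
  (hpage : ∀ (y : bX.carrier) (a : ↥(coresComplement h)), bX.incl y = D.jA a →
    ∃ c : ℝ, 0 < c ∧ w g ((bBase g).incl (Ψ y)).1 = (c : ℂ) * w g (a : Base g).1)

include hlink hpage in
/-- **The twisting sign is CONSTANT on the flat part of `∂ Base g ∖ cores`** (locally constant on a
preconnected set). [cite: EtnyreFuller2006, Thm. 1 (proof, p. 8)] -/
theorem twistSign_eq {y y' : (bBase g).carrier} (hy : (y.1 : Base g) ∈ coresComplement h)
    (hyflat : ‖cx y.1.1‖ ^ 2 < 4) (hy' : (y'.1 : Base g) ∈ coresComplement h) (hy'flat : ‖cx y'.1.1‖ ^ 2 < 4) :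
    twistSign D bX Ψ y = twistSign D bX Ψ y' := by
  have hpre := helper_flatOffCores_preconnected g l h hlink
  have hcont : ContinuousOn (twistSign D bX Ψ)
      {y : (bBase g).carrier | ‖cx y.1.1‖ ^ 2 < 4 ∧ (y.1 : Base g) ∈ coresComplement h} := by
    rintro y₀ ⟨hy₀flat, hy₀⟩
    obtain ⟨c, hc, hy₀c⟩ := exists_mem_page_of_flat hy₀flat ((RegularSublevel.mem_boundary_iff _ _).1 y₀.2)
    have hE := twistSign_eventually_eq D bX Ψ hpage hy₀ hc hy₀c
    refine (continuousWithinAt_const (b := twistSign D bX Ψ y₀)).congr_of_eventuallyEq ?_ rfl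
    rw [Filter.EventuallyEq, eventually_nhdsWithin_iff]
    filter_upwards [hE] with y hy hymem
    exact hy hymem.2 hymem.1
  exact hpre.constant hcont ⟨hyflat, hy⟩ ⟨hy'flat, hy'⟩

include hlink hpage in
/-- **Sub-goal `helper_seam_twistSign_global`, structured form: the global twisting sign.**  There is
`s₀ = ±1` such that for every flat page point `y` off the cores, `y ∈ page g c` (`‖c‖ = 1`), and every
fibred ambient isotopy `R` of `Base g` with `R_1 (seamB y) ∈ page g c`:
`0 < s₀ · pageDet (bdDeriv (R_1 ∘ seamB) y) y`. [cite: EtnyreFuller2006, Thm. 1 (proof, p. 8)] -/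
theorem exists_twistSign_global : ∃ s₀ : ℤ, (s₀ = 1 ∨ s₀ = -1) ∧
    ∀ (y : (bBase g).carrier) (hy : (y.1 : Base g) ∈ coresComplement h) (c : ℂ) (_ : ‖c‖ = 1)
      (_ : y.1 ∈ page g c) (R : AmbientIsotopy (𝓡∂ 4) (Base g))
      (_ : ∀ (t : ℝ) (x : Base g), rho g (R.toFun t x).1 = rho g x.1)
      (_ : ∀ (t : ℝ) (x : Base g), ∃ r : ℝ, 0 < r ∧ w g (R.toFun t x).1 = (r : ℂ) * w g x.1)
      (_ : R.toFun 1 (seamB D bX Ψ y) ∈ page g c),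
      0 < (s₀ : ℝ) * pageDet g (bdDeriv g (R.toFun 1 ∘ seamB D bX Ψ) y) y.1.1 := by
  classical
  by_cases hne : ∃ y : (bBase g).carrier, (y.1 : Base g) ∈ coresComplement h ∧ ‖cx y.1.1‖ ^ 2 < 4
  · obtain ⟨y₀, hy₀, hy₀flat⟩ := hne
    refine ⟨twistSign D bX Ψ y₀, twistSign_eq_one_or D bX Ψ y₀, ?_⟩
    intro y hy c hc hyc R hρR hdirR hR1
    have hflat : ‖cx y.1.1‖ ^ 2 < 4 := (flat_of_mem_page hc hyc).1
    rw [← twistSign_eq hlink D bX Ψ hpage hy hflat hy₀ hy₀flat]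
    obtain ⟨κ, hκ, hκe⟩ := pageDet_flatten_eq D bX Ψ hpage R hρR hdirR hy hc hyc hR1
    have hne0 := twistDet_ne_zero D bX Ψ hpage hy hc hyc
    rw [hκe]
    unfold twistSign
    by_cases h0 : 0 < twistDet D bX Ψ y
    · rw [if_pos h0]; push_cast; positivity
    · rw [if_neg h0]; push_cast
      have : twistDet D bX Ψ y < 0 := lt_of_le_of_ne (not_lt.1 h0) hne0
      nlinarith
  · refine ⟨1, Or.inl rfl, ?_⟩
    intro y hy c hc hyc R _ _ _
    exact absurd ⟨y, hy, (flat_of_mem_page hc hyc).1⟩ hne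

end Global

/-- **Sub-goal `helper_seam_twistSign_global` of stub `stub_T3_dualPresentation`** (T3 ▸ T3c-2 ▸ ST4
`node_ST4_twistSign`, brick X3-5b; wave 5, lead c5): **the global twisting sign of a page-preserving seam
map.**  For a Lefschetz link `h` and the data `(D, bX, Ψ)` of a fibred model with the page clause there
is ONE `s₀ = ±1` such that for every flat page point `y ∈ page g c` of `∂ Base g` off the cores and every
fibred ambient isotopy `R` of `Base g` flattening `seamB y` into `page g c`, the page determinant of the
boundary ambient differential of `R_1 ∘ seamB D bX Ψ` at `y` has sign `s₀`. [cite: EtnyreFuller2006, Thm. 1 (proof, p. 8)] -/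
theorem helper_seam_twistSign_global : ∀ (g : ℕ) (l : List ((Fin g ⊕ Fin g → ℤ) × Bool)) (h : Fin l.length → Literature.Topology.FourManifolds.HandleAttachingMap 3 2 (Literature.Topology.FourManifolds.LefschetzBase.Base g)), Literature.Topology.FourManifolds.LefschetzBase.IsLefschetzLink g l h → ∀ (X : Type) [TopologicalSpace X] [ChartedSpace (EuclideanHalfSpace 4) X] [IsManifold (𝓡∂ 4) ∞ X] (D : Literature.Topology.FourManifolds.HandleAttachingMap.MultiAttachmentData h (𝓡∂ 4) X) (bX : Literature.Topology.FourManifolds.BoundaryData (𝓡∂ 4) X (𝓡 3)) [Nonempty bX.carrier] (Ψ : bX.carrier ≃ₘ⟮𝓡 3, 𝓡 3⟯ (Literature.Topology.FourManifolds.LefschetzBase.bBase g).carrier), (∀ (y : bX.carrier) (a : ↥(Literature.Topology.FourManifolds.HandleAttachingMap.coresComplement h)), bX.incl y = D.jA a → ∃ c : ℝ, 0 < c ∧ Literature.Topology.FourManifolds.LefschetzBase.w g ((Literature.Topology.FourManifolds.LefschetzBase.bBase g).incl (Ψ y)).1 = (c : ℂ) * Literature.Topology.FourManifolds.LefschetzBase.w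 g (a : Literature.Topology.FourManifolds.LefschetzBase.Base g).1) → ∃ s₀ : ℤ, (s₀ = 1 ∨ s₀ = -1) ∧ ∀ (y : (Literature.Topology.FourManifolds.LefschetzBase.bBase g).carrier) (_ : (y.1 : Literature.Topology.FourManifolds.LefschetzBase.Base g) ∈ Literature.Topology.FourManifolds.HandleAttachingMap.coresComplement h) (c : ℂ) (_ : ‖c‖ = 1) (_ : y.1 ∈ Literature.Topology.FourManifolds.LefschetzBase.page g c) (R : Literature.Topology.FourManifolds.AmbientIsotopy (𝓡∂ 4) (Literature.Topology.FourManifolds.LefschetzBase.Base g)) (_ : ∀ (t : ℝ) (x : Literature.Topology.FourManifolds.LefschetzBase.Base g), Literature.Topology.FourManifolds.LefschetzBase.rho g (R.toFun t x).1 = Literature.Topology.FourManifolds.LefschetzBase.rho g x.1) (_ : ∀ (t : ℝ) (x : Literature.Topology.FourManifolds.LefschetzBase.Base g), ∃ r : ℝ, 0 < r ∧ Literature.Topology.FourManifolds.LefschetzBase.w g (R.toFun t x).1 = (r : ℂ) * Literature.Topology.FourManifolds.LefschetzBase.w g x.1) (_ : R.toFun 1 (Summit.SmoothPoincare4.SmoothPoincare4.Theorems.AcyclicBisectionExists.ModpBraidOrbits.seamB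 D bX Ψ y) ∈ Literature.Topology.FourManifolds.LefschetzBase.page g c), 0 < (s₀ : ℝ) * Summit.SmoothPoincare4.SmoothPoincare4.Theorems.AcyclicBisectionExists.ModpBraidOrbits.pageDet g (Summit.SmoothPoincare4.SmoothPoincare4.Theorems.AcyclicBisectionExists.ModpBraidOrbits.bdDeriv g (R.toFun 1 ∘ Summit.SmoothPoincare4.SmoothPoincare4.Theorems.AcyclicBisectionExists.ModpBraidOrbits.seamB D bX Ψ) y) y.1.1 :=
  fun _ _ _ hlink _ _ _ _ D bX _ Ψ hpage => exists_twistSign_global hlink D bX Ψ hpage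

end Summit.SmoothPoincare4.SmoothPoincare4.Theorems.AcyclicBisectionExists.ModpBraidOrbits

end
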